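import Literature.MathematicalPhysics.QuantumFieldTheory.ConformalBootstrap3D.PointKernelK34v2Data
import Literature.MathematicalPhysics.QuantumFieldTheory.ConformalBootstrap3D.PointKernelParts

/-!
# K34v2 certificate, kernel part file P10: one-cell head segments 102, 103 in level ranges

The head cells whose kernel evaluation exceeds one `decide` are one-cell segments of `hsegsK34v2`; each is
checked by `PCert.hPartSideOK` (side conditions) and `PCert.hPartOK` per level range `[n_lo, n_lo + count)`
against an integer claim, the claims summing to `≥ 0` (`PointKernel.partsOK`); soundness is
`PCert.hParts_sound` (`PointKernelParts`).  The part files `P1, P2, …` are mutually independent (each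
imports only the data file); the ranges of one cell may span several of them, and the per-cell
conclusions `hparts_i` / `hcell_i` of those cells are assembled in `PointKernelK34v2.lean`.
Estimated kernel time 242 s.
-/

set_option maxRecDepth 100000
set_option maxHeartbeats 0

namespace Literature.MathematicalPhysics.QuantumFieldTheory.ConformalBootstrap3D.PointKernelK34v2

open Literature.MathematicalPhysics.QuantumFieldTheory.ConformalBootstrap3D.PointKernel

/-- levels `[43, 52)` of segment 102: partial lower sum `≥` claim. [folklore] -/
theorem part_102_2 : certK34v2.hPartOK (PCert.segAt hsegsK34v2 102) JHK34v2 43 9 (499537984855059587985289913323533719) = true := by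
  decide +kernel

/-- levels `[52, 59)` of segment 102: partial lower sum `≥` claim. [folklore] -/
theorem part_102_3 : certK34v2.hPartOK (PCert.segAt hsegsK34v2 102) JHK34v2 52 7 (134203754143944788090414173172828314) = true := by
  decide +kernel

/-- one-cell segment 103 (row 4, cell `[2563/512, 641/128]`, chord, `n_F = 50`,
3 level ranges): side conditions. [folklore] -/
theorem pside_103 : certK34v2.hPartSideOK (PCert.segAt hsegsK34v2 103) JHK34v2 = true := by
  decide +kernel

/-- its level ranges `(n_lo, count, claim)`. [folklore] -/
def parts_103 : List (ℕ × ℕ × ℤ) := [(0, 32, -2262777512380906495680503312841763115), (32, 13, 2005616998377438905455668354770780580), (45, 6, 257160514003467590224834958070982535)]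

/-- the ranges tile `[0, n_F]` and the claims sum to `≥ 0`. [folklore] -/
theorem pcov_103 : PointKernel.partsOK 50 parts_103 = true := by
  decide +kernel

/-- levels `[0, 32)` of segment 103: partial lower sum `≥` claim. [folklore] -/
theorem part_103_0 : certK34v2.hPartOK (PCert.segAt hsegsK34v2 103) JHK34v2 0 32 (-2262777512380906495680503312841763115) = true := by
  decide +kernel

/-- levels `[32, 45)` of segment 103: partial lower sum `≥` claim. [folklore] -/
theorem part_103_1 : certK34v2.hPartOK (PCert.segAt hsegsK34v2 103) JHK34v2 32 13 (2005616998377438905455668354770780580) = true := by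
  decide +kernel

end Literature.MathematicalPhysics.QuantumFieldTheory.ConformalBootstrap3D.PointKernelK34v2
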